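import Summits.NavierStokesRegularity.NavierStokesRegularity.Theorems.WakeRatchetEternalViscousRateCircuitPumpTodaWitness

/-!
# `WakeRatchet.EternalViscousRate` (stmt-NavierStokesRegularity-25647) — bridge to the perpetual-pump programme at FIXED seed:
# the crux BY NAME FORBIDS fine-scale seeded-Toda pumps at every fixed seed (helper; the companion Negative file
# `WakeRatchetEternalViscousRate/Negative/EternalViscousRateFalseOfFineFixedSeedTodaPumps` files the converse as a negative lemma)

THE POINT.  The m = 2 seeded graded Toda circuit `T_ε` of `PerpetualPump.CircuitPump` (stmt-1834, PROVED) is, after zero-padding to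
`Fin 4`, a member of Tao's comparable class `E₂(2/ε)` (`…CircuitPumpTodaClass`, `…CircuitPumpPadClass`), and every exactly
self-similar Type-I non-trivial solution of it at scale ratio `lam` («Toda pump») renormalises to a uniformly bounded admissible
eternal solution with covariant viscosity `ν̂ = 1` at `ε₀ = lam^{2/5} − 1` along which NO rate `a > 1` of tail contraction holds
(`WakeRatchetCircuitPumpNoUniform.not_rateContraction_of_pumpWitness₂`, chain p826303–p827286 of prover-leafhand-ns-wakeratchet-8).
The tree constructs such pumps with the seed `ε = ε(lam) → 0` as `lam ↓ 1` (spread `2/ε(lam) → ∞`), which kills only the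
spread-uniform strengthening of ⟨25647⟩.  This file states the FIXED-SEED form of the bridge in both directions:

* `no_fine_todaPump_of_eternalViscousRate` — **the crux BY NAME ⇒ for every seed `ε ∈ (0, 1]` there is `lam₁ > 1` such that NO Toda
  pump of `T_ε` exists at any scale ratio `lam ∈ (1, lam₁)`**: a proof of ⟨25647⟩ is in particular a NON-EXISTENCE theorem for
  fine-scale pumps at fixed seed (the threshold is `lam₁ = (1+εs(2/ε))^{5/2}` from the crux's `εs` at spread `R = 2/ε`);
* `badScale_of_todaPump` — one fixed-seed pump at scale ratio `lam` kills the inner block of ⟨25647⟩ at spread `2/ε`, scale ratio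
  `ε₀ = lam^{2/5} − 1`, for every rate `a > 1` (padding + class + kill of the chain …CircuitPump*).
The converse direction (fine fixed-seed pumps ⇒ ¬ crux) is the companion Negative file's `EternalViscousRate_false_of_FineFixedSeedTodaPumps`,
modulo the construction item `FineFixedSeedTodaPumps` = census item (d) of HAND9.

WHY THE CONSTRUCTION IS NOT MADE HERE.  The tree's existence engine for the pump (`stub_clockBox` = `toda_clockBox_eps` + window +
bootstrap + INTO/COVER, then Brouwer on truncations, Arzelà–Ascoli, DSS unrolling) needs the clock errors `O(1/log(1/ε))` to be
dominated by the covering margin `(lam^{1/5} − 1)/4`, i.e. `ε ≤ exp(−C/log lam)`: at fixed seed it gives pumps only for `lam` bounded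
below, and no fixed-seed analysis (continuum limit `lam ↓ 1` of the transfer gate) is in the tree or in print.  So
`FineFixedSeedTodaPumps` is OPEN; numerically (rotor-circuit instrument rows on ⟨25646⟩, `εs(R) ≈ 0.2 R^{-0.6}`) surviving fronts at
fixed spread are seen only above a positive threshold, consistent with the crux.  No verdict changes.
HONEST FRAMING: MODEL lattice ODEs only (Tao 2016 §4, §6.4); nothing here is a statement about the Navier–Stokes equations; no registered
stub of skeleton 842b1374 is closed; no summit statement is proved or refuted.
-/

set_option linter.dupNamespace false

noncomputable section

open scoped BigOperators
open Set Real Filter Topology MeasureTheory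

namespace Summit.NavierStokesRegularity.NavierStokesRegularity.Theorems.WakeRatchetCircuitPumpNoUniform

open Summit.NavierStokesRegularity.NavierStokesRegularity.Theorems.CircuitPumpNegative
open Summit.NavierStokesRegularity.NavierStokesRegularity.Theorems.PerpetualPumpCircuitPump
open Summit.NavierStokesRegularity.NavierStokesRegularity.Theorems.WakeRatchetCircuitPumpBdd
open Summit.NavierStokesRegularity.NavierStokesRegularity.Theorems.WakeRatchetCircuitPumpTable
open Summit.NavierStokesRegularity.NavierStokesRegularity.Theorems.WakeRatchetCircuitPumpAssembly
open Summit.NavierStokesRegularity.NavierStokesRegularity.Theorems.WakeRatchetCircuitPumpAction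
open Summit.NavierStokesRegularity.NavierStokesRegularity.Theorems.WakeRatchetCircuitPumpKill
open Summit.NavierStokesRegularity.NavierStokesRegularity.Theorems.WakeRatchetCircuitPumpPad
open Summit.NavierStokesRegularity.NavierStokesRegularity.Theorems.WakeRatchetCircuitPumpPadClass
open Summit.NavierStokesRegularity.NavierStokesRegularity.Theorems.WakeRatchetCircuitPumpTodaClass
open Summit.NavierStokesRegularity.NavierStokesRegularity.Theorems.WakeRatchetViscDSS
open Literature.Analysis.FluidPDE Literature.Analysis.FluidPDE.TaoCascade

/-- **A fixed-seed Toda pump at scale ratio `lam` kills the inner block of ⟨25647⟩ at spread `2/ε` and scale ratio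
`ε₀ = lam^{2/5} − 1`.**  For a seed `ε ∈ (0, 1]` and an exactly self-similar (period 1), Type-I, non-trivial solution `X` of the seeded
Toda circuit `T_ε` at `lam > 1`: there are `ε₀ > 0` with `(1+ε₀)^{5/2} = lam`, the padded table `α ∈ E₂(2/ε)` and a uniformly bounded
admissible eternal `W` with `ν̂ = 1` along which the rate-`a` contraction fails for the given `a > 1`.  (Padding + class + kill of the
session chain …CircuitPump*, with the near-blow-up shell bound from `shellBound_of_typeI`.)  MODEL lattice only.
[cite: Tao2016AveragedNS, §4 Thm. 4.2 (statement shape), the viscous equation before it, §6.4; cell vocabulary (stmt-NavierStokesRegularity-25647)] -/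
theorem badScale_of_todaPump {lam ε : ℝ} (hlam : 1 < lam) (hε : 0 < ε) (hε1 : ε ≤ 1)
    (X : Fin 2 → ℤ → ℝ → ℝ) (hode : SolvesODE lam (fun (i₁ i₂ i₃ : Fin 2) (μ : Option (Fin 3)) => if μ = none then (if i₁ = 1 ∧ i₂ = 1 ∧ i₃ = 0
                then (-1 : ℝ) else if i₁ = 1 ∧ i₂ = 0 ∧ i₃ = 1 then 1 / 2 else if i₁ = 0 ∧ i₂ = 1 ∧ i₃ = 1
                then 1 / 2 else if i₁ = 0 ∧ i₂ = 0 ∧ i₃ = 1 then ε else if i₁ = 0 ∧ i₂ = 1 ∧ i₃ = 0 then -ε /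
                2 else if i₁ = 1 ∧ i₂ = 0 ∧ i₃ = 0 then -ε / 2 else 0) else if μ = some 2 then (if i₁ = 1 ∧
                i₂ = 1 ∧ i₃ = 0 then 1 else 0) else if μ = some 1 then (if i₁ = 1 ∧ i₂ = 0 ∧ i₃ = 1 then -1 /
                2 else 0) else (if i₁ = 0 ∧ i₂ = 1 ∧ i₃ = 1 then -1 / 2 else 0)) X) (hdss : IsDSS lam 1 X) (hTI : IsTypeI lam X)
    (hnt : IsNontrivial X) {a : ℝ} (ha : 1 < a) :
    ∃ ε₀ : ℝ, 0 < ε₀ ∧ (1 + ε₀) ^ ((5 : ℝ) / 2) = lam ∧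
      ∃ α : Fin 4 → Fin 4 → Fin 4 → ℤ × ℤ × ℤ → ℝ, InTableClass (2 / ε) α ∧
        ∃ W : ℤ → ℝ → Em 4, IsEternalVisc ε₀ 1 α W ∧ UniformBound W ∧
          ¬ ∀ (n : ℤ) (M : ℝ), (∀ σ : ℝ, ∑' k : ℕ, physEnergy ε₀ W (n + k) σ ≤ M) →
              ∀ σ : ℝ, ∑' k : ℕ, physEnergy ε₀ W (n + 1 + k) σ ≤ (1 + ε₀) ^ (-a) * M := by
  have hbd := shellBound_of_typeI hlam _ X hode hTI
  -- pad to four modes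
  have hode₄ := solvesODE_pad (k := 2) hode
  have hdss₄ := isDSS_pad (k := 2) hdss
  have hTI₄ := isTypeI_pad (k := 2) hlam hTI
  have hnt₄ := isNontrivial_pad (k := 2) hnt
  have hbd₄ : ∀ n : ℤ, ∃ P : ℝ, ∀ t : ℝ, -(1 / 2) ≤ t → t < 0 →
      ‖shellVec (Fin.append X (fun (_ : Fin 2) (_ : ℤ) (_ : ℝ) => (0 : ℝ))) n t‖ ≤ P := by
    intro n
    obtain ⟨P, hP⟩ := hbd n
    exact ⟨P, fun t h1 h2 => by rw [norm_shellVec_pad]; exact hP t h1 h2⟩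
  -- the padded pulled-back table is the padding of the m = 2 Toda member of `E₂(2/ε)`
  have h2 : InTableClass (2 / ε) (fun (i₁ i₂ i₃ : Fin 2) (μ : ℤ × ℤ × ℤ) =>
            if μ = (0, 0, 0) then (fun (i₁ i₂ i₃ : Fin 2) (μ : Option (Fin 3)) => if μ = none then (if i₁ = 1 ∧ i₂ = 1 ∧ i₃ = 0
              then (-1 : ℝ) else if i₁ = 1 ∧ i₂ = 0 ∧ i₃ = 1 then 1 / 2 else if i₁ = 0 ∧ i₂ = 1 ∧ i₃ = 1
              then 1 / 2 else if i₁ = 0 ∧ i₂ = 0 ∧ i₃ = 1 then ε else if i₁ = 0 ∧ i₂ = 1 ∧ i₃ = 0 then -ε /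
              2 else if i₁ = 1 ∧ i₂ = 0 ∧ i₃ = 0 then -ε / 2 else 0) else if μ = some 2 then (if i₁ = 1 ∧
              i₂ = 1 ∧ i₃ = 0 then 1 else 0) else if μ = some 1 then (if i₁ = 1 ∧ i₂ = 0 ∧ i₃ = 1 then -1 /
              2 else 0) else (if i₁ = 0 ∧ i₂ = 1 ∧ i₃ = 1 then -1 / 2 else 0)) i₁ i₂ i₃ none
            else if μ = (1, 0, 0) then (fun (i₁ i₂ i₃ : Fin 2) (μ : Option (Fin 3)) => if μ = none then (if i₁ = 1 ∧ i₂ = 1 ∧ i₃ = 0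
              then (-1 : ℝ) else if i₁ = 1 ∧ i₂ = 0 ∧ i₃ = 1 then 1 / 2 else if i₁ = 0 ∧ i₂ = 1 ∧ i₃ = 1
              then 1 / 2 else if i₁ = 0 ∧ i₂ = 0 ∧ i₃ = 1 then ε else if i₁ = 0 ∧ i₂ = 1 ∧ i₃ = 0 then -ε /
              2 else if i₁ = 1 ∧ i₂ = 0 ∧ i₃ = 0 then -ε / 2 else 0) else if μ = some 2 then (if i₁ = 1 ∧
              i₂ = 1 ∧ i₃ = 0 then 1 else 0) else if μ = some 1 then (if i₁ = 1 ∧ i₂ = 0 ∧ i₃ = 1 then -1 /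
              2 else 0) else (if i₁ = 0 ∧ i₂ = 1 ∧ i₃ = 1 then -1 / 2 else 0)) i₁ i₂ i₃ (some 0)
            else if μ = (0, 1, 0) then (fun (i₁ i₂ i₃ : Fin 2) (μ : Option (Fin 3)) => if μ = none then (if i₁ = 1 ∧ i₂ = 1 ∧ i₃ = 0
              then (-1 : ℝ) else if i₁ = 1 ∧ i₂ = 0 ∧ i₃ = 1 then 1 / 2 else if i₁ = 0 ∧ i₂ = 1 ∧ i₃ = 1
              then 1 / 2 else if i₁ = 0 ∧ i₂ = 0 ∧ i₃ = 1 then ε else if i₁ = 0 ∧ i₂ = 1 ∧ i₃ = 0 then -ε /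
              2 else if i₁ = 1 ∧ i₂ = 0 ∧ i₃ = 0 then -ε / 2 else 0) else if μ = some 2 then (if i₁ = 1 ∧
              i₂ = 1 ∧ i₃ = 0 then 1 else 0) else if μ = some 1 then (if i₁ = 1 ∧ i₂ = 0 ∧ i₃ = 1 then -1 /
              2 else 0) else (if i₁ = 0 ∧ i₂ = 1 ∧ i₃ = 1 then -1 / 2 else 0)) i₁ i₂ i₃ (some 1)
            else if μ = (0, 0, 1) then (fun (i₁ i₂ i₃ : Fin 2) (μ : Option (Fin 3)) => if μ = none then (if i₁ = 1 ∧ i₂ = 1 ∧ i₃ = 0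
              then (-1 : ℝ) else if i₁ = 1 ∧ i₂ = 0 ∧ i₃ = 1 then 1 / 2 else if i₁ = 0 ∧ i₂ = 1 ∧ i₃ = 1
              then 1 / 2 else if i₁ = 0 ∧ i₂ = 0 ∧ i₃ = 1 then ε else if i₁ = 0 ∧ i₂ = 1 ∧ i₃ = 0 then -ε /
              2 else if i₁ = 1 ∧ i₂ = 0 ∧ i₃ = 0 then -ε / 2 else 0) else if μ = some 2 then (if i₁ = 1 ∧
              i₂ = 1 ∧ i₃ = 0 then 1 else 0) else if μ = some 1 then (if i₁ = 1 ∧ i₂ = 0 ∧ i₃ = 1 then -1 /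
              2 else 0) else (if i₁ = 0 ∧ i₂ = 1 ∧ i₃ = 1 then -1 / 2 else 0)) i₁ i₂ i₃ (some 2) else 0) := by
    rw [toda_pullback_eq ε]
    exact todaTable_inTableClass ε hε hε1
  have hclass : InTableClass (2 / ε) (fun (j₁ j₂ j₃ : Fin (2 + 2)) (μ : ℤ × ℤ × ℤ) =>
            if μ = (0, 0, 0) then (Fin.append (fun i₁ : Fin 2 => Fin.append (fun i₂ : Fin 2 => Fin.append ((fun (i₁ i₂ i₃ : Fin 2) (μ : Option (Fin 3)) => if μ = none then (if i₁ = 1 ∧ i₂ = 1 ∧ i₃ = 0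
              then (-1 : ℝ) else if i₁ = 1 ∧ i₂ = 0 ∧ i₃ = 1 then 1 / 2 else if i₁ = 0 ∧ i₂ = 1 ∧ i₃ = 1
              then 1 / 2 else if i₁ = 0 ∧ i₂ = 0 ∧ i₃ = 1 then ε else if i₁ = 0 ∧ i₂ = 1 ∧ i₃ = 0 then -ε /
              2 else if i₁ = 1 ∧ i₂ = 0 ∧ i₃ = 0 then -ε / 2 else 0) else if μ = some 2 then (if i₁ = 1 ∧
              i₂ = 1 ∧ i₃ = 0 then 1 else 0) else if μ = some 1 then (if i₁ = 1 ∧ i₂ = 0 ∧ i₃ = 1 then -1 /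
              2 else 0) else (if i₁ = 0 ∧ i₂ = 1 ∧ i₃ = 1 then -1 / 2 else 0)) i₁ i₂)
              (fun (_ : Fin 2) (_ : Option (Fin 3)) => (0 : ℝ)))
            (fun (_ : Fin 2) (_ : Fin (2 + 2)) (_ : Option (Fin 3)) => (0 : ℝ)))
            (fun (_ : Fin 2) (_ : Fin (2 + 2)) (_ : Fin (2 + 2)) (_ : Option (Fin 3)) => (0 : ℝ))) j₁ j₂ j₃ none
            else if μ = (1, 0, 0) then (Fin.append (fun i₁ : Fin 2 => Fin.append (fun i₂ : Fin 2 => Fin.append ((fun (i₁ i₂ i₃ : Fin 2) (μ : Option (Fin 3)) => if μ = none then (if i₁ = 1 ∧ i₂ = 1 ∧ i₃ = 0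
              then (-1 : ℝ) else if i₁ = 1 ∧ i₂ = 0 ∧ i₃ = 1 then 1 / 2 else if i₁ = 0 ∧ i₂ = 1 ∧ i₃ = 1
              then 1 / 2 else if i₁ = 0 ∧ i₂ = 0 ∧ i₃ = 1 then ε else if i₁ = 0 ∧ i₂ = 1 ∧ i₃ = 0 then -ε /
              2 else if i₁ = 1 ∧ i₂ = 0 ∧ i₃ = 0 then -ε / 2 else 0) else if μ = some 2 then (if i₁ = 1 ∧
              i₂ = 1 ∧ i₃ = 0 then 1 else 0) else if μ = some 1 then (if i₁ = 1 ∧ i₂ = 0 ∧ i₃ = 1 then -1 /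
              2 else 0) else (if i₁ = 0 ∧ i₂ = 1 ∧ i₃ = 1 then -1 / 2 else 0)) i₁ i₂)
              (fun (_ : Fin 2) (_ : Option (Fin 3)) => (0 : ℝ)))
            (fun (_ : Fin 2) (_ : Fin (2 + 2)) (_ : Option (Fin 3)) => (0 : ℝ)))
            (fun (_ : Fin 2) (_ : Fin (2 + 2)) (_ : Fin (2 + 2)) (_ : Option (Fin 3)) => (0 : ℝ))) j₁ j₂ j₃ (some 0)
            else if μ = (0, 1, 0) then (Fin.append (fun i₁ : Fin 2 => Fin.append (fun i₂ : Fin 2 => Fin.append ((fun (i₁ i₂ i₃ : Fin 2) (μ : Option (Fin 3)) => if μ = none then (if i₁ = 1 ∧ i₂ = 1 ∧ i₃ = 0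
              then (-1 : ℝ) else if i₁ = 1 ∧ i₂ = 0 ∧ i₃ = 1 then 1 / 2 else if i₁ = 0 ∧ i₂ = 1 ∧ i₃ = 1
              then 1 / 2 else if i₁ = 0 ∧ i₂ = 0 ∧ i₃ = 1 then ε else if i₁ = 0 ∧ i₂ = 1 ∧ i₃ = 0 then -ε /
              2 else if i₁ = 1 ∧ i₂ = 0 ∧ i₃ = 0 then -ε / 2 else 0) else if μ = some 2 then (if i₁ = 1 ∧
              i₂ = 1 ∧ i₃ = 0 then 1 else 0) else if μ = some 1 then (if i₁ = 1 ∧ i₂ = 0 ∧ i₃ = 1 then -1 /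
              2 else 0) else (if i₁ = 0 ∧ i₂ = 1 ∧ i₃ = 1 then -1 / 2 else 0)) i₁ i₂)
              (fun (_ : Fin 2) (_ : Option (Fin 3)) => (0 : ℝ)))
            (fun (_ : Fin 2) (_ : Fin (2 + 2)) (_ : Option (Fin 3)) => (0 : ℝ)))
            (fun (_ : Fin 2) (_ : Fin (2 + 2)) (_ : Fin (2 + 2)) (_ : Option (Fin 3)) => (0 : ℝ))) j₁ j₂ j₃ (some 1)
            else if μ = (0, 0, 1) then (Fin.append (fun i₁ : Fin 2 => Fin.append (fun i₂ : Fin 2 => Fin.append ((fun (i₁ i₂ i₃ : Fin 2) (μ : Option (Fin 3)) => if μ = none then (if i₁ = 1 ∧ i₂ = 1 ∧ i₃ = 0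
              then (-1 : ℝ) else if i₁ = 1 ∧ i₂ = 0 ∧ i₃ = 1 then 1 / 2 else if i₁ = 0 ∧ i₂ = 1 ∧ i₃ = 1
              then 1 / 2 else if i₁ = 0 ∧ i₂ = 0 ∧ i₃ = 1 then ε else if i₁ = 0 ∧ i₂ = 1 ∧ i₃ = 0 then -ε /
              2 else if i₁ = 1 ∧ i₂ = 0 ∧ i₃ = 0 then -ε / 2 else 0) else if μ = some 2 then (if i₁ = 1 ∧
              i₂ = 1 ∧ i₃ = 0 then 1 else 0) else if μ = some 1 then (if i₁ = 1 ∧ i₂ = 0 ∧ i₃ = 1 then -1 /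
              2 else 0) else (if i₁ = 0 ∧ i₂ = 1 ∧ i₃ = 1 then -1 / 2 else 0)) i₁ i₂)
              (fun (_ : Fin 2) (_ : Option (Fin 3)) => (0 : ℝ)))
            (fun (_ : Fin 2) (_ : Fin (2 + 2)) (_ : Option (Fin 3)) => (0 : ℝ)))
            (fun (_ : Fin 2) (_ : Fin (2 + 2)) (_ : Fin (2 + 2)) (_ : Option (Fin 3)) => (0 : ℝ))) j₁ j₂ j₃ (some 2) else 0) := by
    rw [pullback_pad_comm]
    exact inTableClass_pad (k := 2) h2
  -- kill at `ε₀ = lam^{2/5} - 1`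
  obtain ⟨ε₁, W, hε₁, hlamε, hW, hUB, hnot⟩ :=
    not_rateContraction_of_pumpWitness₂ hlam _ hclass.2.1 _ hode₄ hdss₄ hTI₄ hnt₄ hbd₄ ha
  exact ⟨ε₁, hε₁, hlamε, _, hclass, W, hW, hUB, hnot⟩

/-- **The crux BY NAME forbids fine-scale Toda pumps at every fixed seed.**  If `WakeRatchet.EternalViscousRate` holds then for every
seed `ε ∈ (0, 1]` there is `lam₁ > 1` such that for all `lam ∈ (1, lam₁)` the seeded Toda circuit `T_ε` carries NO exactly self-similar
(period 1) Type-I non-trivial solution at scale ratio `lam` (`lam₁ = (1+εs)^{5/2}` with `εs` the crux's threshold at spread `2/ε`).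
MODEL lattice only; the crux is the hypothesis, nothing is asserted about it.
[cite: Tao2016AveragedNS, §4 Thm. 4.2 (statement shape), the viscous equation before it, §6.4; cell vocabulary (stmt-NavierStokesRegularity-25647)] -/
theorem no_fine_todaPump_of_eternalViscousRate
    (hK : Summit.NavierStokesRegularity.NavierStokesRegularity.Theses.WakeRatchet.EternalViscousRate)
    (ε : ℝ) (hε : 0 < ε) (hε1 : ε ≤ 1) :
    ∃ lam₁ : ℝ, 1 < lam₁ ∧ ∀ lam : ℝ, 1 < lam → lam < lam₁ →
      ∀ X : Fin 2 → ℤ → ℝ → ℝ, SolvesODE lam (fun (i₁ i₂ i₃ : Fin 2) (μ : Option (Fin 3)) => if μ = none then (if i₁ = 1 ∧ i₂ = 1 ∧ i₃ = 0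
                then (-1 : ℝ) else if i₁ = 1 ∧ i₂ = 0 ∧ i₃ = 1 then 1 / 2 else if i₁ = 0 ∧ i₂ = 1 ∧ i₃ = 1
                then 1 / 2 else if i₁ = 0 ∧ i₂ = 0 ∧ i₃ = 1 then ε else if i₁ = 0 ∧ i₂ = 1 ∧ i₃ = 0 then -ε /
                2 else if i₁ = 1 ∧ i₂ = 0 ∧ i₃ = 0 then -ε / 2 else 0) else if μ = some 2 then (if i₁ = 1 ∧
                i₂ = 1 ∧ i₃ = 0 then 1 else 0) else if μ = some 1 then (if i₁ = 1 ∧ i₂ = 0 ∧ i₃ = 1 then -1 /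
                2 else 0) else (if i₁ = 0 ∧ i₂ = 1 ∧ i₃ = 1 then -1 / 2 else 0)) X → IsDSS lam 1 X → IsTypeI lam X → ¬ IsNontrivial X := by
  have hR : (1 : ℝ) ≤ 2 / ε := by
    rw [le_div_iff₀ hε]; linarith
  obtain ⟨a, ha, εs, hεs, H⟩ := hK (2 / ε) hR
  refine ⟨(1 + εs) ^ ((5 : ℝ) / 2), Real.one_lt_rpow (by linarith) (by norm_num), ?_⟩
  intro lam hlam hlt X hode hdss hTI hnt
  obtain ⟨ε₀, hε₀, hlamε, α, hα, W, hW, hU, hnot⟩ := badScale_of_todaPump hlam hε hε1 X hode hdss hTI hnt ha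
  have hε₀le : ε₀ ≤ εs := by
    by_contra hcon
    have h1 : (1 + εs) ^ ((5 : ℝ) / 2) ≤ (1 + ε₀) ^ ((5 : ℝ) / 2) :=
      Real.rpow_le_rpow (by linarith) (by linarith) (by norm_num)
    rw [hlamε] at h1
    linarith
  exact hnot (H ε₀ hε₀ hε₀le α hα 1 W one_pos hW hU)

/-- **Under the crux, the seed of every fine-scale Toda pump must tend to zero — UNIFORMLY: for every `ε₁ ∈ (0, 1]` there is
`lam₁ > 1` such that NO seed `ε ∈ [ε₁, 1]` carries a Toda pump at ANY scale ratio `lam ∈ (1, lam₁)`.**  (All the tables `T_ε`,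
`ε ≥ ε₁`, lie in the single class `E₂(2/ε₁)` by monotonicity of the comparable class in the spread, `InTableClass.mono`; the crux's
threshold `εs(2/ε₁)` gives `lam₁ = (1+εs)^{5/2}`.)  Read against the tree's PROVED pump `PerpetualPumpCircuitPump.todaPump_at` (a pump
at every `lam ∈ (1, 3/2]` with SOME seed `ε(lam)`): `EternalViscousRate` holds only if `ε(lam) → 0` as `lam ↓ 1` for EVERY family of
pumps — the crux is exactly the statement that the fixed-seed pump branch does not reach `lam = 1`.  MODEL lattice only; the crux is
the hypothesis, nothing is asserted about it.
[cite: Tao2016AveragedNS, §4 Thm. 4.2 (statement shape), the viscous equation before it, §6.1, §6.4; cell vocabulary (stmt-NavierStokesRegularity-25647)] -/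
theorem todaPump_seed_lt_of_eternalViscousRate
    (hK : Summit.NavierStokesRegularity.NavierStokesRegularity.Theses.WakeRatchet.EternalViscousRate)
    (ε₁ : ℝ) (hε₁ : 0 < ε₁) (hε₁1 : ε₁ ≤ 1) :
    ∃ lam₁ : ℝ, 1 < lam₁ ∧ ∀ lam : ℝ, 1 < lam → lam < lam₁ → ∀ ε : ℝ, ε₁ ≤ ε → ε ≤ 1 →
      ∀ X : Fin 2 → ℤ → ℝ → ℝ, SolvesODE lam (fun (i₁ i₂ i₃ : Fin 2) (μ : Option (Fin 3)) => if μ = none then (if i₁ = 1 ∧ i₂ = 1 ∧ i₃ = 0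
                then (-1 : ℝ) else if i₁ = 1 ∧ i₂ = 0 ∧ i₃ = 1 then 1 / 2 else if i₁ = 0 ∧ i₂ = 1 ∧ i₃ = 1
                then 1 / 2 else if i₁ = 0 ∧ i₂ = 0 ∧ i₃ = 1 then ε else if i₁ = 0 ∧ i₂ = 1 ∧ i₃ = 0 then -ε /
                2 else if i₁ = 1 ∧ i₂ = 0 ∧ i₃ = 0 then -ε / 2 else 0) else if μ = some 2 then (if i₁ = 1 ∧
                i₂ = 1 ∧ i₃ = 0 then 1 else 0) else if μ = some 1 then (if i₁ = 1 ∧ i₂ = 0 ∧ i₃ = 1 then -1 /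
                2 else 0) else (if i₁ = 0 ∧ i₂ = 1 ∧ i₃ = 1 then -1 / 2 else 0)) X → IsDSS lam 1 X → IsTypeI lam X → ¬ IsNontrivial X := by
  have hR : (1 : ℝ) ≤ 2 / ε₁ := by
    rw [le_div_iff₀ hε₁]; linarith
  obtain ⟨a, ha, εs, hεs, H⟩ := hK (2 / ε₁) hR
  refine ⟨(1 + εs) ^ ((5 : ℝ) / 2), Real.one_lt_rpow (by linarith) (by norm_num), ?_⟩
  intro lam hlam hlt ε hε₁ε hε1 X hode hdss hTI hnt
  have hε : 0 < ε := lt_of_lt_of_le hε₁ hε₁ε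
  obtain ⟨ε₀, hε₀, hlamε, α, hα, W, hW, hU, hnot⟩ := badScale_of_todaPump hlam hε hε1 X hode hdss hTI hnt ha
  have hε₀le : ε₀ ≤ εs := by
    by_contra hcon
    have h1 : (1 + εs) ^ ((5 : ℝ) / 2) ≤ (1 + ε₀) ^ ((5 : ℝ) / 2) :=
      Real.rpow_le_rpow (by linarith) (by linarith) (by norm_num)
    rw [hlamε] at h1
    linarith
  have hRR : 2 / ε ≤ 2 / ε₁ := div_le_div_of_nonneg_left (by norm_num) hε₁ hε₁ε
  have hα' : InTableClass (2 / ε₁) α := hα.mono (by positivity) hRR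
  exact hnot (H ε₀ hε₀ hε₀le α hα' 1 W one_pos hW hU)

end Summit.NavierStokesRegularity.NavierStokesRegularity.Theorems.WakeRatchetCircuitPumpNoUniform

end
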